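import Summits.CriticalPhenomena.CardyFormulaZ2.Theorems.CardyBoundaryCoulombGasStripClusterRatesOfRectilinearCardy
import Summits.CriticalPhenomena.CardyFormulaZ2.Theorems.CardyBoundaryCoulombGasStripClusterRatesRectCardyOneOfRectilinearCardy
import Summits.CriticalPhenomena.CardyFormulaZ2.Theorems.CardyBoundaryCoulombGasStripClusterRatesTwoClusterKacIffKacTwo

/-!
# `StripClusterRates` against the conjunct: the γ₁-half is a corollary of `CardyFormulaZ2`, and under
# `CardyFormulaZ2` the crux is equivalent to the two-cluster Kac gap statement K₂

Support file for line `two-cluster-rate-is-stationary-gap` (crux `StripClusterRates`,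
stmt-CriticalPhenomena-13878), lead c4. The route `CardyBoundaryCoulombGas` serves the conjunct
`CardyFormulaZ2` (Cardy's formula for bond-`ℤ²` in EVERY conformal rectangle) through its crux 4
`RectilinearCardy` (the same for rectilinear conformal rectangles). Since the conjunct quantifies over all
conformal rectangles, `RectilinearCardy ⟸ CardyFormulaZ2` is a one-line specialisation
(`rectilinearCardy_of_cardyFormulaZ2`; the converse is the proved support `RectilinearSuffices`). Fed into
the landed chain of leads −1 and c3 (`oneClusterKac_of_rectilinearCardy`,
`stripClusterRates_of_rectilinearCardy_of_kacTwo`, `twoClusterKac_iff_kacTwo`) this records, in the kernel: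

* `oneClusterKac_of_cardyFormulaZ2` — the γ₁-half of the crux (`n·γ₁(n) → π/3` for every family of
  one-cluster lengthwise rates) is a COROLLARY OF THE CONJUNCT the route is meant to prove;
* `kacTwo_of_stripClusterRates` — unconditionally, the crux implies K₂
  (`n·(−log s(n)) → 2π` for every family `s` of relaxation moduli of the stationary connectivity chains
  `planarTransfer (Finset.Icc 0 n)`, = registered stub `stub_kacTwo`);
* `stripClusterRates_of_cardyFormulaZ2_of_kacTwo` and `stripClusterRates_iff_kacTwo_of_cardyFormulaZ2` —
  under the conjunct, the crux is EQUIVALENT to K₂ alone.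

So everything in `StripClusterRates` that is not already implied by the conjunct is the `h_{1,5} = 2` gap
asymptotics K₂ of the two-cluster sector (Cardy 1998, eq. (bb), n = 2, transfer-matrix order of limits).
No definitions are introduced.
-/

noncomputable section

namespace Summit.CriticalPhenomena.CardyFormulaZ2.Cruxes.StripClusterRates.TwoClusterRateIsStationaryGap

open Filter Topology
open Literature.Probability.Percolation Literature.Probability.LatticeModels

/-- **The conjunct specialises to crux 4**: Cardy's formula for every conformal rectangle
(`CardyFormulaZ2`) gives it in particular for the rectilinear ones (`RectilinearCardy`). [folklore] -/
theorem rectilinearCardy_of_cardyFormulaZ2 (h : _root_.CardyFormulaZ2) :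
    Summit.CriticalPhenomena.CardyFormulaZ2.Theses.CardyBoundaryCoulombGas.RectilinearCardy :=
  fun R _ => h R

/-- **The γ₁-half of `StripClusterRates` is a corollary of the conjunct**: under `CardyFormulaZ2`, every
family of one-cluster lengthwise rates `γ₁(n) = lim_m −log P_{1/2}[LR crossing of [0,m]×[0,n]]/m`
(`n ≥ 1`) has the Kac limit `n·γ₁(n) → π/3 = π·h_{1,3}` (lead −1's sandwich chain through
`oneClusterKac_of_rectilinearCardy`). [cite: Cardy1998, eq. (bb)] -/
theorem oneClusterKac_of_cardyFormulaZ2 :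
    _root_.CardyFormulaZ2 → ∀ γ : ℕ → ℝ, (∀ n : ℕ, 1 ≤ n →
      Tendsto (fun m : ℕ ↦ -Real.log (crossingProb half m n) / (m : ℝ)) atTop (𝓝 (γ n))) →
      Tendsto (fun n : ℕ ↦ (n : ℝ) * γ n) atTop (𝓝 (Real.pi / 3)) :=
  fun h γ hγ => oneClusterKac_of_rectilinearCardy (rectilinearCardy_of_cardyFormulaZ2 h) γ hγ

/-- **The crux implies K₂** (unconditionally): from `StripClusterRates`, `n·(−log s(n)) → 2π` for every
family `s` of relaxation moduli (second-largest eigenvalue moduli of the unmarked blocks of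
`planarTransfer (Finset.Icc 0 n)`, `n ≥ 1`). The crux provides ONE family of two-cluster rates with the
Kac limit; any other family agrees with it at every `n ≥ 1` (limits are unique), and
`twoClusterKac_iff_kacTwo` transports the limit to the moduli. [cite: Cardy1998, eq. (bb)] -/
theorem kacTwo_of_stripClusterRates :
    Summit.CriticalPhenomena.CardyFormulaZ2.Theses.CardyBoundaryCoulombGas.StripClusterRates → ∀ s : ℕ → ℝ,
      (∀ n : ℕ, 1 ≤ n →
        ((∃ (μ : ℂ) (v : PlanarRowState (Finset.Icc (0 : ℤ) n) → ℂ),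
          (v ≠ 0 ∧ (∀ p, (∃ x, p.1.JoinedToStar x) → v p = 0) ∧
            ∀ p, (∀ x, ¬ p.1.JoinedToStar x) →
              ∑ q, (planarTransfer (Finset.Icc (0 : ℤ) n) p q : ℂ) * v q = μ * v p) ∧
          μ ≠ 1 ∧ ‖μ‖ = s n) ∧
        ∀ (μ : ℂ) (v : PlanarRowState (Finset.Icc (0 : ℤ) n) → ℂ),
          (v ≠ 0 ∧ (∀ p, (∃ x, p.1.JoinedToStar x) → v p = 0) ∧
            ∀ p, (∀ x, ¬ p.1.JoinedToStar x) →
              ∑ q, (planarTransfer (Finset.Icc (0 : ℤ) n) p q : ℂ) * v q = μ * v p) →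
          μ ≠ 1 → ‖μ‖ ≤ s n)) →
      Tendsto (fun n : ℕ ↦ (n : ℝ) * -Real.log (s n)) atTop (𝓝 (2 * Real.pi)) := by
  rintro ⟨γ₁, γ₂, -, h₂, -, h₄⟩
  refine twoClusterKac_iff_kacTwo.mp ?_
  intro γ hγ
  refine h₄.congr' ?_
  filter_upwards [eventually_ge_atTop 1] with n hn
  rw [tendsto_nhds_unique (hγ n hn) (h₂ n hn)]

/-- **`StripClusterRates` ⟸ conjunct ∧ K₂**: if Cardy's formula holds for bond-`ℤ²` (`CardyFormulaZ2`)
and the relaxation moduli have the Kac asymptotics `n·(−log s(n)) → 2π` (K₂, = registered stub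
`stub_kacTwo`), then the crux holds (`stripClusterRates_of_rectilinearCardy_of_kacTwo` fed with
`rectilinearCardy_of_cardyFormulaZ2`). [cite: Cardy1998, eq. (bb)] -/
theorem stripClusterRates_of_cardyFormulaZ2_of_kacTwo (h : _root_.CardyFormulaZ2)
    (hK₂ : ∀ s : ℕ → ℝ,
      (∀ n : ℕ, 1 ≤ n →
        ((∃ (μ : ℂ) (v : PlanarRowState (Finset.Icc (0 : ℤ) n) → ℂ),
          (v ≠ 0 ∧ (∀ p, (∃ x, p.1.JoinedToStar x) → v p = 0) ∧
            ∀ p, (∀ x, ¬ p.1.JoinedToStar x) →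
              ∑ q, (planarTransfer (Finset.Icc (0 : ℤ) n) p q : ℂ) * v q = μ * v p) ∧
          μ ≠ 1 ∧ ‖μ‖ = s n) ∧
        ∀ (μ : ℂ) (v : PlanarRowState (Finset.Icc (0 : ℤ) n) → ℂ),
          (v ≠ 0 ∧ (∀ p, (∃ x, p.1.JoinedToStar x) → v p = 0) ∧
            ∀ p, (∀ x, ¬ p.1.JoinedToStar x) →
              ∑ q, (planarTransfer (Finset.Icc (0 : ℤ) n) p q : ℂ) * v q = μ * v p) →
          μ ≠ 1 → ‖μ‖ ≤ s n)) →
      Tendsto (fun n : ℕ ↦ (n : ℝ) * -Real.log (s n)) atTop (𝓝 (2 * Real.pi))) :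
    Summit.CriticalPhenomena.CardyFormulaZ2.Theses.CardyBoundaryCoulombGas.StripClusterRates :=
  stripClusterRates_of_rectilinearCardy_of_kacTwo (rectilinearCardy_of_cardyFormulaZ2 h) hK₂

/-- **Under the conjunct, the crux IS K₂**: assuming `CardyFormulaZ2`, `StripClusterRates` holds if and
only if the relaxation moduli of the stationary connectivity chains have the Kac asymptotics
`n·(−log s(n)) → 2π = π·h_{1,5}`. Everything in the crux not implied by the conjunct is this one
spectral-gap statement. [cite: Cardy1998, eq. (bb)] -/
theorem stripClusterRates_iff_kacTwo_of_cardyFormulaZ2 :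
    _root_.CardyFormulaZ2 →
    (Summit.CriticalPhenomena.CardyFormulaZ2.Theses.CardyBoundaryCoulombGas.StripClusterRates ↔ ∀ s : ℕ → ℝ,
      (∀ n : ℕ, 1 ≤ n →
        ((∃ (μ : ℂ) (v : PlanarRowState (Finset.Icc (0 : ℤ) n) → ℂ),
          (v ≠ 0 ∧ (∀ p, (∃ x, p.1.JoinedToStar x) → v p = 0) ∧
            ∀ p, (∀ x, ¬ p.1.JoinedToStar x) →
              ∑ q, (planarTransfer (Finset.Icc (0 : ℤ) n) p q : ℂ) * v q = μ * v p) ∧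
          μ ≠ 1 ∧ ‖μ‖ = s n) ∧
        ∀ (μ : ℂ) (v : PlanarRowState (Finset.Icc (0 : ℤ) n) → ℂ),
          (v ≠ 0 ∧ (∀ p, (∃ x, p.1.JoinedToStar x) → v p = 0) ∧
            ∀ p, (∀ x, ¬ p.1.JoinedToStar x) →
              ∑ q, (planarTransfer (Finset.Icc (0 : ℤ) n) p q : ℂ) * v q = μ * v p) →
          μ ≠ 1 → ‖μ‖ ≤ s n)) →
      Tendsto (fun n : ℕ ↦ (n : ℝ) * -Real.log (s n)) atTop (𝓝 (2 * Real.pi))) :=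
  fun h => ⟨kacTwo_of_stripClusterRates, stripClusterRates_of_cardyFormulaZ2_of_kacTwo h⟩

end Summit.CriticalPhenomena.CardyFormulaZ2.Cruxes.StripClusterRates.TwoClusterRateIsStationaryGap

end
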